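import Mathlib
import HarnessLib
import Summits.QuantumAdvantage.QuantumAdvantage.Theorems.SoloInformedQuadraticLocalization

/-!
# Deletion numbers of bounded quadratic forms via Grothendieck factorization

Solo seat `solo-QuantumAdvantage-informed`, session 12, file 29 (§4.26 (5) of the seat's paper: the
DELETION CONJECTURE DC stated there is a theorem).

Setting (file 28, `SoloInformedQuadraticLocalization`): `q(x) = c + ⟨b,x⟩ + xᵀAx ∈ [lo, hi]` on `{−1,1}ⁿ`,
`A` real symmetric with zero diagonal — the acceptance probability of a one-query quantum algorithm is
such a `q` with `[lo, hi] = [0, 1]`. The seat's degree-2 classical simulation theorem with depth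
`O(ε⁻² · log(1/δ) · log(log(1/δ)/ε))` (paper, Proposition E) was conditional on

  DC: for every `o > 0` some set `F` of `O(1/o)` coordinates has `‖A_{FᶜFᶜ}‖_op ≤ o`, uniformly in `n`.

DC follows from GROTHENDIECK'S INEQUALITY IN FACTORIZATION FORM (Grothendieck 1953; Lindenstrauss–
Pełczyński 1968; A. Pisier, *Grothendieck's theorem, past and present*, Bull. AMS 49 (2012),
arXiv:1101.4195, Theorem 2.1; J. Tropp, *Column subset selection, matrix factorization, and eigenvalue
optimization*, SODA 2009, arXiv:0806.4404, Theorem 12 and Proposition 13): every real square matrix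
factors as `A = D₁ T D₂` with `Dᵢ` nonnegative diagonal, `tr Dᵢ² = 1`, `‖T‖_op ≤ K_G · ‖A‖_{∞→1}`
(`K_G < 1.783` the real Grothendieck constant), and `D₁ = D₂` when `A` is symmetric; equivalently there is
a probability vector `w` with `|xᵀAy| ≤ K_G‖A‖_{∞→1} · (∑ wᵢxᵢ²)^{1/2} · (∑ wᵢyᵢ²)^{1/2}` for all real
`x, y`. Deleting the coordinates of weight `wᵢ > τ` — fewer than `1/τ` of them — leaves a principal
submatrix of operator norm `≤ K_G‖A‖_{∞→1} · τ` (Tropp's Proposition 13 is the case `τ = 2/n`).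

Grothendieck's inequality is not in Mathlib; this file kernel-checks the two problem-side steps and takes
the factorization as an explicit hypothesis (`hfac`):

* `polarization`, `sign_bilinear_abs_le` (F4 of the paper's LEMMA L): for symmetric zero-diagonal `A`
  with `c + xᵀAx ∈ [lo, hi]` at every vertex, `|sᵀAt| ≤ hi − lo` for all sign vectors `s, t`, i.e.
  `‖A‖_{∞→1} ≤ hi − lo` — polarization through the midpoints `(s ± t)/2`, which lie in the solid cube,
  and file 28's multi-affine extension `quadForm_cube_extension`. This is the input to the factorization.
* `deletion_of_factorization`: if `|xᵀAy| ≤ K (∑ wᵢxᵢ²)^{1/2} (∑ wᵢyᵢ²)^{1/2}` for all `x, y`, with `w ≥ 0`,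
  `∑ wᵢ ≤ 1`, then for every `τ > 0` the set `F := {i : wᵢ > τ}` has `|F| · τ ≤ 1` and
  `|xᵀAy| ≤ K τ ‖x‖₂ ‖y‖₂` for all `x, y` vanishing on `F` (Markov + Cauchy–Schwarz bookkeeping);
  `deletion_number_le` is the `o`-form: `|F| ≤ K/o` and `|xᵀAy| ≤ o ‖x‖₂ ‖y‖₂` off `F`.

Consequences recorded in the paper (§4.26 (5), session 12): `N_del(A, o) < K_G/o` for every bounded
quadratic (the two-block example needs `(3/32)/o`); Proposition E is unconditional — every bounded
polynomial of degree `≤ 2`, in particular every one-query quantum algorithm's acceptance probability, is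
`(ε,δ)`-simulated by a classical decision tree of depth `O(ε⁻² log(1/δ) log(log(1/δ)/ε))`, against the
necessary `Ω(ε⁻² log(1/δ))` (Proposition D); and the degree-2 deletion window of Proposition F closes at
its bottom, `sup_A N′_del(A; p, t) = Θ(p/t)`.
-/

namespace Summit.QuantumAdvantage.QuantumAdvantage.Theorems

namespace BoundedQuadratic

open Finset

variable {n : ℕ}

/-- The bilinear form `∑ᵢⱼ Aᵢⱼ xᵢ yⱼ` of a symmetric matrix is symmetric. -/
theorem bilin_symm (A : Matrix (Fin n) (Fin n) ℝ) (hA : ∀ i j, A i j = A j i) (s t : Fin n → ℝ) :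
    ∑ i, ∑ j, A i j * t i * s j = ∑ i, ∑ j, A i j * s i * t j := by
  rw [Finset.sum_comm]
  exact sum_congr rfl fun i _ => sum_congr rfl fun j _ => by rw [hA i j]; ring

/-- **Polarization.** For symmetric `A`: `(s+t)ᵀA(s+t) − (s−t)ᵀA(s−t) = 4·sᵀAt`. -/
theorem polarization (A : Matrix (Fin n) (Fin n) ℝ) (hA : ∀ i j, A i j = A j i) (s t : Fin n → ℝ) :
    quadForm A (fun i => s i + t i) - quadForm A (fun i => s i - t i) =
      4 * ∑ i, ∑ j, A i j * s i * t j := by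
  unfold quadForm
  rw [← sum_sub_distrib]
  have hrow : ∀ i, (∑ j, A i j * (s i + t i) * (s j + t j)) - ∑ j, A i j * (s i - t i) * (s j - t j)
      = ∑ j, (2 * (A i j * s i * t j) + 2 * (A i j * t i * s j)) := by
    intro i
    rw [← sum_sub_distrib]
    exact sum_congr rfl fun j _ => by ring
  rw [sum_congr rfl fun i _ => hrow i]
  simp only [sum_add_distrib, ← mul_sum]
  rw [bilin_symm A hA s t]
  ring

/-- Midpoints `(s ± t)/2` of two vertices lie in the solid cube `[−1,1]ⁿ`. -/
lemma midpoint_inCube {s t : Fin n → ℝ} (hs : IsSignVec s) (ht : IsSignVec t) :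
    InCube (fun i => 2⁻¹ * (s i + t i)) ∧ InCube (fun i => 2⁻¹ * (s i - t i)) := by
  constructor <;> intro i <;> rcases hs i with h1 | h1 <;> rcases ht i with h2 | h2 <;>
    norm_num [h1, h2]

/-- **F4 — the `∞→1` norm of a bounded quadratic form.** If `A` is symmetric with zero diagonal and
`c + xᵀAx ∈ [lo, hi]` at every vertex of the cube, then `|sᵀAt| ≤ hi − lo` for all sign vectors
`s, t`; i.e. `‖A‖_{∞→1} = max_{s,t ∈ {−1,1}ⁿ} sᵀAt ≤ hi − lo`. -/
theorem sign_bilinear_abs_le (A : Matrix (Fin n) (Fin n) ℝ) (hA : ∀ i j, A i j = A j i)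
    (hdiag : ∀ i, A i i = 0) {c lo hi : ℝ}
    (hbd : ∀ x, IsSignVec x → lo ≤ c + quadForm A x ∧ c + quadForm A x ≤ hi)
    {s t : Fin n → ℝ} (hs : IsSignVec s) (ht : IsSignVec t) :
    |∑ i, ∑ j, A i j * s i * t j| ≤ hi - lo := by
  obtain ⟨hu, hv⟩ := midpoint_inCube hs ht
  have hU := quadForm_cube_extension A hdiag hbd _ hu
  have hV := quadForm_cube_extension A hdiag hbd _ hv
  have hpol := polarization A hA s t
  have e1 : quadForm A (fun i => s i + t i) = 2 ^ 2 * quadForm A (fun i => 2⁻¹ * (s i + t i)) := by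
    have h : (fun i => s i + t i) = (fun i => (2:ℝ) * (2⁻¹ * (s i + t i))) := by
      funext i; ring
    rw [h, quadForm_smul]
  have e2 : quadForm A (fun i => s i - t i) = 2 ^ 2 * quadForm A (fun i => 2⁻¹ * (s i - t i)) := by
    have h : (fun i => s i - t i) = (fun i => (2:ℝ) * (2⁻¹ * (s i - t i))) := by
      funext i; ring
    rw [h, quadForm_smul]
  rw [abs_le]
  constructor <;> linarith [hU.1, hU.2, hV.1, hV.2, hpol, e1, e2]

/-- In the paper's normalisation `q ∈ [0,1]`: `‖A‖_{∞→1} ≤ 1`. -/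
theorem sign_bilinear_abs_le_one (c : ℝ) (b : Fin n → ℝ) (A : Matrix (Fin n) (Fin n) ℝ)
    (hA : ∀ i j, A i j = A j i) (hdiag : ∀ i, A i i = 0)
    (hq : ∀ x, IsSignVec x →
      0 ≤ c + ∑ i, b i * x i + quadForm A x ∧ c + ∑ i, b i * x i + quadForm A x ≤ 1)
    {s t : Fin n → ℝ} (hs : IsSignVec s) (ht : IsSignVec t) :
    |∑ i, ∑ j, A i j * s i * t j| ≤ 1 := by
  -- pass to the even part `c + xᵀAx = (q(x) + q(−x))/2 ∈ [0,1]`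
  have heven : ∀ x, IsSignVec x → 0 ≤ c + quadForm A x ∧ c + quadForm A x ≤ 1 := by
    intro x hx
    have hnx : IsSignVec (fun i => -x i) := fun i => by
      rcases hx i with h | h <;> simp [h]
    have h1 := hq x hx
    have h2 := hq _ hnx
    have hqn : quadForm A (fun i => -x i) = quadForm A x := by
      have : (fun i => -x i) = (fun i => (-1:ℝ) * x i) := by funext i; ring
      rw [this, quadForm_smul]; ring
    have hbn : ∑ i, b i * (-x i) = -∑ i, b i * x i := by
      rw [← sum_neg_distrib]; exact sum_congr rfl fun i _ => by ring
    rw [hqn, hbn] at h2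
    constructor <;> linarith [h1.1, h1.2, h2.1, h2.2]
  have := sign_bilinear_abs_le A hA hdiag (c := c) (lo := 0) (hi := 1) heven hs ht
  linarith

/-- **Deletion from a factorization (Markov on the Grothendieck weights).** If
`|xᵀAy| ≤ K · (∑ wᵢxᵢ²)^{1/2} · (∑ wᵢyᵢ²)^{1/2}` for all real `x, y`, with `w ≥ 0` and `∑ wᵢ ≤ 1`, then
for every `τ > 0` the set `F = {i : wᵢ > τ}` satisfies `|F|·τ ≤ 1`, and `|xᵀAy| ≤ K·τ·‖x‖₂·‖y‖₂` for
all `x, y` vanishing on `F` — the principal submatrix on `Fᶜ` has operator norm `≤ Kτ`. -/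
theorem deletion_of_factorization (A : Matrix (Fin n) (Fin n) ℝ) {K τ : ℝ} (hK : 0 ≤ K) (hτ : 0 < τ)
    (w : Fin n → ℝ) (hw : ∀ i, 0 ≤ w i) (hw1 : ∑ i, w i ≤ 1)
    (hfac : ∀ x y : Fin n → ℝ, |∑ i, ∑ j, A i j * x i * y j| ≤
      K * Real.sqrt (∑ i, w i * x i ^ 2) * Real.sqrt (∑ i, w i * y i ^ 2)) :
    ∃ F : Finset (Fin n), (F.card : ℝ) * τ ≤ 1 ∧
      ∀ x y : Fin n → ℝ, (∀ i ∈ F, x i = 0) → (∀ i ∈ F, y i = 0) →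
        |∑ i, ∑ j, A i j * x i * y j| ≤
          K * τ * Real.sqrt (∑ i, x i ^ 2) * Real.sqrt (∑ i, y i ^ 2) := by
  classical
  refine ⟨univ.filter fun i => τ < w i, ?_, ?_⟩
  · have h1 : ((univ.filter fun i => τ < w i).card : ℝ) * τ
        = ∑ i ∈ univ.filter (fun i => τ < w i), τ := by
      rw [sum_const, nsmul_eq_mul]
    rw [h1]
    calc ∑ i ∈ univ.filter (fun i => τ < w i), τ
        ≤ ∑ i ∈ univ.filter (fun i => τ < w i), w i :=
          sum_le_sum fun i hi => le_of_lt (mem_filter.mp hi).2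
      _ ≤ ∑ i, w i := sum_le_sum_of_subset_of_nonneg (filter_subset _ _) fun i _ _ => hw i
      _ ≤ 1 := hw1
  · have mass : ∀ x : Fin n → ℝ, (∀ i ∈ univ.filter (fun i => τ < w i), x i = 0) →
        ∑ i, w i * x i ^ 2 ≤ τ * ∑ i, x i ^ 2 := by
      intro x hx
      rw [mul_sum]
      refine sum_le_sum fun i _ => ?_
      by_cases hi : τ < w i
      · have : x i = 0 := hx i (mem_filter.mpr ⟨mem_univ _, hi⟩)
        simp [this]
      · exact mul_le_mul_of_nonneg_right (not_lt.mp hi) (sq_nonneg _)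
    have root : ∀ x : Fin n → ℝ, (∀ i ∈ univ.filter (fun i => τ < w i), x i = 0) →
        Real.sqrt (∑ i, w i * x i ^ 2) ≤ Real.sqrt τ * Real.sqrt (∑ i, x i ^ 2) := by
      intro x hx
      rw [← Real.sqrt_mul hτ.le]
      exact Real.sqrt_le_sqrt (mass x hx)
    intro x y hx hy
    have hx' := root x hx
    have hy' := root y hy
    have hτ2 : Real.sqrt τ * Real.sqrt τ = τ := Real.mul_self_sqrt hτ.le
    calc |∑ i, ∑ j, A i j * x i * y j|
        ≤ K * Real.sqrt (∑ i, w i * x i ^ 2) * Real.sqrt (∑ i, w i * y i ^ 2) := hfac x y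
      _ ≤ K * (Real.sqrt τ * Real.sqrt (∑ i, x i ^ 2)) * Real.sqrt (∑ i, w i * y i ^ 2) := by
          apply mul_le_mul_of_nonneg_right _ (Real.sqrt_nonneg _)
          exact mul_le_mul_of_nonneg_left hx' hK
      _ ≤ K * (Real.sqrt τ * Real.sqrt (∑ i, x i ^ 2)) * (Real.sqrt τ * Real.sqrt (∑ i, y i ^ 2)) := by
          apply mul_le_mul_of_nonneg_left hy'
          exact mul_nonneg hK (mul_nonneg (Real.sqrt_nonneg _) (Real.sqrt_nonneg _))
      _ = K * (Real.sqrt τ * Real.sqrt τ) * Real.sqrt (∑ i, x i ^ 2) * Real.sqrt (∑ i, y i ^ 2) := by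
          ring
      _ = K * τ * Real.sqrt (∑ i, x i ^ 2) * Real.sqrt (∑ i, y i ^ 2) := by rw [hτ2]

/-- **Deletion number bound — the paper's DC, `o`-form.** Under a factorization with constant `K > 0`
(Grothendieck: `K = K_G · ‖A‖_{∞→1}`, and `‖A‖_{∞→1} ≤ 1` for a bounded quadratic by
`sign_bilinear_abs_le_one`), for every `o > 0` at most `K/o` coordinates can be deleted so that the
bilinear form of the remaining principal submatrix is bounded by `o ‖x‖₂ ‖y‖₂`, i.e. `N_del(A, o) ≤ K/o`. -/
theorem deletion_number_le (A : Matrix (Fin n) (Fin n) ℝ) {K : ℝ} (hK : 0 < K)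
    (w : Fin n → ℝ) (hw : ∀ i, 0 ≤ w i) (hw1 : ∑ i, w i ≤ 1)
    (hfac : ∀ x y : Fin n → ℝ, |∑ i, ∑ j, A i j * x i * y j| ≤
      K * Real.sqrt (∑ i, w i * x i ^ 2) * Real.sqrt (∑ i, w i * y i ^ 2))
    {o : ℝ} (ho : 0 < o) :
    ∃ F : Finset (Fin n), (F.card : ℝ) ≤ K / o ∧
      ∀ x y : Fin n → ℝ, (∀ i ∈ F, x i = 0) → (∀ i ∈ F, y i = 0) →
        |∑ i, ∑ j, A i j * x i * y j| ≤ o * Real.sqrt (∑ i, x i ^ 2) * Real.sqrt (∑ i, y i ^ 2) := by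
  obtain ⟨F, hcard, hF⟩ := deletion_of_factorization A hK.le (div_pos ho hK) w hw hw1 hfac
  have hKo : K * (o / K) = o := by field_simp
  refine ⟨F, ?_, fun x y hx hy => ?_⟩
  · rw [le_div_iff₀ ho]
    calc (F.card : ℝ) * o = (F.card : ℝ) * (o / K) * K := by
          rw [mul_assoc, div_mul_cancel₀ o hK.ne']
      _ ≤ 1 * K := mul_le_mul_of_nonneg_right hcard hK.le
      _ = K := one_mul K
  · have h := hF x y hx hy
    rw [hKo] at h
    exact h

/-- The same deletion bounds the paper's `M_p` functional (Proposition F): for `x, y` vanishing on `F`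
with `‖x‖₂², ‖y‖₂² ≤ p`, `|xᵀAy| ≤ o · p`; hence `N′_del(A; p, t) ≤ N_del(A, t/p) ≤ K p / t`. -/
theorem deletion_number_le_Mp (A : Matrix (Fin n) (Fin n) ℝ) {K : ℝ} (hK : 0 < K)
    (w : Fin n → ℝ) (hw : ∀ i, 0 ≤ w i) (hw1 : ∑ i, w i ≤ 1)
    (hfac : ∀ x y : Fin n → ℝ, |∑ i, ∑ j, A i j * x i * y j| ≤
      K * Real.sqrt (∑ i, w i * x i ^ 2) * Real.sqrt (∑ i, w i * y i ^ 2))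
    {o p : ℝ} (ho : 0 < o) (hp : 0 ≤ p) :
    ∃ F : Finset (Fin n), (F.card : ℝ) ≤ K / o ∧
      ∀ x y : Fin n → ℝ, (∀ i ∈ F, x i = 0) → (∀ i ∈ F, y i = 0) →
        ∑ i, x i ^ 2 ≤ p → ∑ i, y i ^ 2 ≤ p →
        |∑ i, ∑ j, A i j * x i * y j| ≤ o * p := by
  obtain ⟨F, hcard, hF⟩ := deletion_number_le A hK w hw hw1 hfac ho
  refine ⟨F, hcard, fun x y hx hy hxp hyp => ?_⟩
  have h := hF x y hx hy
  have hsx : Real.sqrt (∑ i, x i ^ 2) ≤ Real.sqrt p := Real.sqrt_le_sqrt hxp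
  have hsy : Real.sqrt (∑ i, y i ^ 2) ≤ Real.sqrt p := Real.sqrt_le_sqrt hyp
  have hpp : Real.sqrt p * Real.sqrt p = p := Real.mul_self_sqrt hp
  calc |∑ i, ∑ j, A i j * x i * y j|
      ≤ o * Real.sqrt (∑ i, x i ^ 2) * Real.sqrt (∑ i, y i ^ 2) := h
    _ ≤ o * Real.sqrt p * Real.sqrt (∑ i, y i ^ 2) := by
        apply mul_le_mul_of_nonneg_right _ (Real.sqrt_nonneg _)
        exact mul_le_mul_of_nonneg_left hsx ho.le
    _ ≤ o * Real.sqrt p * Real.sqrt p := by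
        apply mul_le_mul_of_nonneg_left hsy
        exact mul_nonneg ho.le (Real.sqrt_nonneg _)
    _ = o * p := by rw [mul_assoc, hpp]

end BoundedQuadratic

end Summit.QuantumAdvantage.QuantumAdvantage.Theorems
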